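import Summits.BirchSwinnertonDyer.BirchSwinnertonDyer.Theorems.BiquadraticEisensteinDescentHeegnerTwistCouplingInSupplySqrtTwoDual
import HarnessLib

set_option linter.dupNamespace false -- `Summit.BirchSwinnertonDyer.BirchSwinnertonDyer.Theorems.…` (summit = sub)
set_option autoImplicit false

/-!
# Crux `HeegnerTwistCouplingInSupply` (stmt-BirchSwinnertonDyer-21381) — card `sqrt2-isogeny-heegner-pin`: the corners for the isogenous
# member `W = B_{−2p} : y² = x³ − 8p x² + 8p² x`, `p ≡ 5 (mod 8)` — T_A′, the generic rung′ and the row rung′, modulo Burungale–Tian +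
# Deuring–Hecke

Route `BiquadraticEisensteinDescent` (cell `pub/bsd-wall`, width seat `bsd-wall-cm-bed-w1` g10; `--supports` 21381, helper). Sequel of
`…SqrtTwoDual` (CELL-5′ for `B_{2m} = ⟨0, 8m, 0, 8m², 0⟩`, `L_one_ne_zero_dual`, support `N(B_{−2p}) ⊆ {2, p}`, twist literals). Same
pins, witness fields and class-number certificates as the `B_p` corners (`…SqrtTwoPin`, `…PartnerLadder`, `…SqrtTwoLadder`): for the
Heegner field `K′ = ℚ(√−5ℓ)` / `ℚ(√−ℓq₀)` one has `B_{−2p}^{(d_{K′})} = B_{2m}`, `m = 5pℓ` / `p·ℓ·q₀ ∈` CELL-5′.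

* ★★ `cruxOnBdualCorner_of_two_facts` — T_A′: every prime `p ≡ 5 (mod 8)`, `p ≡ ±2 (mod 5)`;
* ★ `cruxOnBdualCornerPartner_of_two_facts` — rung′: prime `q₀ ≡ 5 (mod 8)`, `(q₀/p) = −1`, `p ≥ P` with `8⁸q₀⁵ ≤ (2.718·3.1415)⁸P³`
  (instances: `…SqrtTwoLadder.hkey_thirteen/…/hkey_sixtyOne`);
* ★ `cruxOnBdualCornerRow_of_two_facts` — row′: explicit `ℓ ≡ 3`, `q₀ ≡ 5 (mod 8)`, `(ℓ/p) = (q₀/p) = −1`, `classNumberCount(ℓq₀) < p`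
  (instances: `…SqrtTwoLadderRows.row_five/…`).

Each gives the CONCLUSION of crux 21381 for `W = B_{−2p}` (Heegner `K′` of `N(B_{−2p})`, `4 < |d|`, `L(B_{−2p}^{(d)}, 1) ≠ 0`, `h(K′) < p`,
`p ∤ h(K′)`) modulo Burungale–Tian + Deuring–Hecke ONLY. HONEST FRAMING: sub-corner rungs on one CM family; the crux (all CM `W`; residual C⁺)
and BSD are NOT proved by any of this. THEOREMS ONLY; supports stmt-BirchSwinnertonDyer-21381.
-/

noncomputable section

open scoped Classical

namespace Summit.BirchSwinnertonDyer.BirchSwinnertonDyer.Theorems.BiquadraticEisensteinDescentHeegnerTwistCouplingInSupplySqrtTwoDualCorner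

open _root_.WeierstrassCurve Literature.NumberTheory.EllipticCurves Literature.NumberTheory.EllipticCurves.HeathBrown1994.Families
open Literature.NumberTheory.QuadraticFields.Quadratic
open Summit.BirchSwinnertonDyer.BirchSwinnertonDyer.Theorems.BiquadraticEisensteinDescentHeegnerTwistCouplingInSupplySqrtTwoCell
open Summit.BirchSwinnertonDyer.BirchSwinnertonDyer.Theorems.BiquadraticEisensteinDescentHeegnerTwistCouplingInSupplySqrtTwoPin
open Summit.BirchSwinnertonDyer.BirchSwinnertonDyer.Theorems.BiquadraticEisensteinDescentHeegnerTwistCouplingInSupplySqrtTwoLadder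
open Summit.BirchSwinnertonDyer.BirchSwinnertonDyer.Theorems.BiquadraticEisensteinDescentHeegnerTwistCouplingInSupplyPartnerLadder
open Summit.BirchSwinnertonDyer.BirchSwinnertonDyer.Theorems.BiquadraticEisensteinDescentHeegnerTwistCouplingInSupplySqrtTwoDual

/-- The `L`-half for `W = B_{−2p}` from three distinct primes `p, ℓ, q` all `≡ 3, 5 (mod 8)`: `L(B_{2·pℓq}, 1) ≠ 0`. [cite: BurungaleTian2026, Thm. 1.1] -/
theorem L_one_ne_zero_dual_of_primes (hBT : burungaleTian_analyticRank_eq_zero_of_selmerCorank_eq_zero_of_hasCM)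
    (hH : hasEntireLFunction_of_j_mem_maximalCMJInvariants) {p l q : ℕ} (hp : p.Prime) (hl : l.Prime) (hq : q.Prime)
    (hpl : p ≠ l) (hpq : p ≠ q) (hlq : l ≠ q) (hp8 : p % 8 = 3 ∨ p % 8 = 5) (hl8 : l % 8 = 3 ∨ l % 8 = 5)
    (hq8 : q % 8 = 3 ∨ q % 8 = 5) :
    (⟨0, 8 * (((p * l * q : ℕ) : ℤ) : ℚ), 0, 8 * (((p * l * q : ℕ) : ℤ) : ℚ) ^ 2, 0⟩ : WeierstrassCurve ℚ).entireLFunction 1 ≠ 0 := by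
  obtain ⟨hsq, hfac⟩ := squarefree_mul_mul_of_primes hp hl hq hpl hpq hlq
  have hm0 : (0 : ℤ) < ((p * l * q : ℕ) : ℤ) := by
    have := hp.pos
    have := hl.pos
    have := hq.pos
    positivity
  have hm8 : ∀ r : ℕ, r.Prime → (r : ℤ) ∣ ((p * l * q : ℕ) : ℤ) → r % 8 = 3 ∨ r % 8 = 5 := by
    intro r hr hrd
    rcases hfac r hr (by exact_mod_cast hrd) with rfl | rfl | rfl <;> assumption
  haveI := isElliptic_dual hm0.ne'
  exact (L_one_ne_zero_dual hBT hH hm0 (Int.squarefree_natCast.mpr hsq) hm8).2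

/-- ★★ **T_A′ — corner for `W = B_{−2p}`, every prime `p ≡ 5 (mod 8)`, `p ≡ ±2 (mod 5)`, two named facts**: `K′ = ℚ(√−5ℓ)` (`ℓ` the pin
of `pinThreeMinus_of_mod_eight_eq_five`) is Heegner for `N(B_{−2p})`, `4 < |d|`, `L(B_{−2p}^{(d)}, 1) ≠ 0` (`B_{−2p}^{(−5ℓ)} = B_{2m}`,
`m = 5pℓ ∈` CELL-5′), `h(K′) < p`, `p ∤ h(K′)`. [cite: BurungaleTian2026, Thm. 1.1] [cite: SilvermanAEC2009, Prop. X.4.9 and Thm. X.4.2(a)]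
[cite: Oesterle1988Gauss, II §3 Proposition p. 57 (27)] -/
theorem cruxOnBdualCorner_of_two_facts (hBT : burungaleTian_analyticRank_eq_zero_of_selmerCorank_eq_zero_of_hasCM)
    (hH : hasEntireLFunction_of_j_mem_maximalCMJInvariants) :
    ∀ (p : ℕ) [Fact p.Prime] [(⟨0, -8 * (p : ℚ), 0, 8 * (p : ℚ) ^ 2, 0⟩ : WeierstrassCurve ℚ).IsElliptic]
      [(⟨0, -8 * (p : ℚ), 0, 8 * (p : ℚ) ^ 2, 0⟩ : WeierstrassCurve ℚ).IsGloballyMinimal]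
      [NeZero ((⟨0, -8 * (p : ℚ), 0, 8 * (p : ℚ) ^ 2, 0⟩ : WeierstrassCurve ℚ).conductorNorm ℤ)],
      p % 8 = 5 → (p % 5 = 2 ∨ p % 5 = 3) →
      ∃ (K : Type) (_ : Field K) (_ : NumberField K),
        IsImaginaryQuadratic K ∧ 4 < (NumberField.discr K).natAbs ∧
        SatisfiesHeegnerHypothesis ((⟨0, -8 * (p : ℚ), 0, 8 * (p : ℚ) ^ 2, 0⟩ : WeierstrassCurve ℚ).conductorNorm ℤ) K ∧
        ((⟨0, -8 * (p : ℚ), 0, 8 * (p : ℚ) ^ 2, 0⟩ : WeierstrassCurve ℚ).quadraticTwist (NumberField.discr K : ℚ)).entireLFunction 1 ≠ 0 ∧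
        NumberField.classNumber K < p ∧ ¬ p ∣ NumberField.classNumber K := by
  intro p hpF _ _ _ hp8 hp5
  have hp : p.Prime := hpF.out
  obtain ⟨ℓ, K, iF, iN, hℓ, hℓp, hℓ8, -, -, -, hK, hdK, hH', hcl, -, -⟩ :=
    exists_sqrtTwoPin_witnessField hp hp8 hp5 (N := (⟨0, -8 * (p : ℚ), 0, 8 * (p : ℚ) ^ 2, 0⟩ : WeierstrassCurve ℚ).conductorNorm ℤ)
      (fun r hr hrN => eq_two_or_eq_of_prime_dvd_conductorNorm_Bdual hp hr hrN)
  refine ⟨K, iF, iN, hK, ?_, hH', ?_, hcl, fun hdvd =>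
    absurd (Nat.le_of_dvd (NumberField.classNumber_pos K) hdvd) (not_le.mpr hcl)⟩
  · rw [hdK, Int.natAbs_neg, Int.natAbs_natCast]
    have := hℓ.two_le
    omega
  · rw [hdK, quadraticTwist_Bdual_neg_mul]
    exact L_one_ne_zero_dual_of_primes hBT hH hp Nat.prime_five hℓ (by rintro rfl; omega) (by omega) (by rintro rfl; omega)
      (Or.inr hp8) (Or.inr (by norm_num)) (Or.inl hℓ8)

/-- ★ **Generic rung′ for `W = B_{−2p}`** (partner `q₀ ≡ 5 (mod 8)`, `(q₀/p) = −1`, size lever `c = q₀` above the threshold).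
[cite: BurungaleTian2026, Thm. 1.1] [cite: Oesterle1988Gauss, II §3 Proposition p. 57 (27)] -/
theorem cruxOnBdualCornerPartner_of_two_facts (hBT : burungaleTian_analyticRank_eq_zero_of_selmerCorank_eq_zero_of_hasCM)
    (hH : hasEntireLFunction_of_j_mem_maximalCMJInvariants) {q₀ P : ℕ} (hq₀ : q₀.Prime) (hq₀8 : q₀ % 8 = 5)
    (hkey : (8 : ℝ) ^ 8 * ((q₀ : ℕ) : ℝ) ^ 5 ≤ (2.718 * 3.1415) ^ 8 * (P : ℝ) ^ 3) :
    ∀ (p : ℕ) [Fact p.Prime] [(⟨0, -8 * (p : ℚ), 0, 8 * (p : ℚ) ^ 2, 0⟩ : WeierstrassCurve ℚ).IsElliptic]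
      [(⟨0, -8 * (p : ℚ), 0, 8 * (p : ℚ) ^ 2, 0⟩ : WeierstrassCurve ℚ).IsGloballyMinimal]
      [NeZero ((⟨0, -8 * (p : ℚ), 0, 8 * (p : ℚ) ^ 2, 0⟩ : WeierstrassCurve ℚ).conductorNorm ℤ)],
      p % 8 = 5 → jacobiSym (q₀ : ℤ) p = -1 → P ≤ p →
      ∃ (K : Type) (_ : Field K) (_ : NumberField K),
        IsImaginaryQuadratic K ∧ 4 < (NumberField.discr K).natAbs ∧
        SatisfiesHeegnerHypothesis ((⟨0, -8 * (p : ℚ), 0, 8 * (p : ℚ) ^ 2, 0⟩ : WeierstrassCurve ℚ).conductorNorm ℤ) K ∧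
        ((⟨0, -8 * (p : ℚ), 0, 8 * (p : ℚ) ^ 2, 0⟩ : WeierstrassCurve ℚ).quadraticTwist (NumberField.discr K : ℚ)).entireLFunction 1 ≠ 0 ∧
        NumberField.classNumber K < p ∧ ¬ p ∣ NumberField.classNumber K := by
  intro p hpF _ _ _ hp8 hJq hPp
  have hp : p.Prime := hpF.out
  obtain ⟨ℓ, hℓ, hℓp, hℓ8, hJℓ⟩ := pinThreeMinus_of_mod_eight_eq_five p hp hp8
  have hJ : jacobiSym (-((ℓ * q₀ : ℕ) : ℤ)) p = 1 := jacobiSym_neg_mul_eq_one_of_mod_four_eq_one (by omega) hJℓ hJq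
  have hxc : ((ℓ * q₀ : ℕ) : ℝ) < (q₀ : ℝ) * p := by
    have h1 : ℓ * q₀ < q₀ * p := by have := hq₀.pos; nlinarith
    exact_mod_cast h1
  obtain ⟨K, iF, iN, hK, hdK, hH', hcl⟩ := exists_witnessField_of
    (N := (⟨0, -8 * (p : ℚ), 0, 8 * (p : ℚ) ^ 2, 0⟩ : WeierstrassCurve ℚ).conductorNorm ℤ) hℓ hℓ8 hq₀ hq₀8 hJ
    (classNumber_lt_of_lever hℓ hq₀ hq₀8 hxc hkey hPp) (fun r hr hrN => eq_two_or_eq_of_prime_dvd_conductorNorm_Bdual hp hr hrN)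
  refine ⟨K, iF, iN, hK, ?_, hH', ?_, hcl, fun hdvd =>
    absurd (Nat.le_of_dvd (NumberField.classNumber_pos K) hdvd) (not_le.mpr hcl)⟩
  · rw [hdK, Int.natAbs_neg, Int.natAbs_natCast]
    have h3 : 3 ≤ ℓ := by have := hℓ.two_le; omega
    have h5 : 5 ≤ q₀ := by have := hq₀.two_le; omega
    nlinarith
  · rw [hdK, quadraticTwist_Bdual_neg_mul]
    exact L_one_ne_zero_dual_of_primes hBT hH hp hℓ hq₀ (by omega) (ne_of_jacobiSym_eq_neg_one hp hJq).symm
      (by rintro rfl; omega) (Or.inr hp8) (Or.inl hℓ8) (Or.inr hq₀8)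

/-- ★ **Row rung′ for `W = B_{−2p}`** (explicit `ℓ ≡ 3`, `q₀ ≡ 5 (mod 8)`, `(ℓ/p) = (q₀/p) = −1`, Cohen count `classNumberCount(ℓq₀) < p`).
[cite: BurungaleTian2026, Thm. 1.1] [cite: Cohen1993, §5.3.1 Algorithm 5.3.5] -/
theorem cruxOnBdualCornerRow_of_two_facts (hBT : burungaleTian_analyticRank_eq_zero_of_selmerCorank_eq_zero_of_hasCM)
    (hH : hasEntireLFunction_of_j_mem_maximalCMJInvariants) {ℓ q₀ : ℕ} (hℓ : ℓ.Prime) (hℓ8 : ℓ % 8 = 3) (hq₀ : q₀.Prime)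
    (hq₀8 : q₀ % 8 = 5) :
    ∀ (p : ℕ) [Fact p.Prime] [(⟨0, -8 * (p : ℚ), 0, 8 * (p : ℚ) ^ 2, 0⟩ : WeierstrassCurve ℚ).IsElliptic]
      [(⟨0, -8 * (p : ℚ), 0, 8 * (p : ℚ) ^ 2, 0⟩ : WeierstrassCurve ℚ).IsGloballyMinimal]
      [NeZero ((⟨0, -8 * (p : ℚ), 0, 8 * (p : ℚ) ^ 2, 0⟩ : WeierstrassCurve ℚ).conductorNorm ℤ)],
      p % 8 = 5 → jacobiSym (ℓ : ℤ) p = -1 → jacobiSym (q₀ : ℤ) p = -1 → BinQF.classNumberCount (ℓ * q₀) < p →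
      ∃ (K : Type) (_ : Field K) (_ : NumberField K),
        IsImaginaryQuadratic K ∧ 4 < (NumberField.discr K).natAbs ∧
        SatisfiesHeegnerHypothesis ((⟨0, -8 * (p : ℚ), 0, 8 * (p : ℚ) ^ 2, 0⟩ : WeierstrassCurve ℚ).conductorNorm ℤ) K ∧
        ((⟨0, -8 * (p : ℚ), 0, 8 * (p : ℚ) ^ 2, 0⟩ : WeierstrassCurve ℚ).quadraticTwist (NumberField.discr K : ℚ)).entireLFunction 1 ≠ 0 ∧
        NumberField.classNumber K < p ∧ ¬ p ∣ NumberField.classNumber K := by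
  intro p hpF _ _ _ hp8 hJℓ hJq hh
  have hp : p.Prime := hpF.out
  have hJ : jacobiSym (-((ℓ * q₀ : ℕ) : ℤ)) p = 1 := jacobiSym_neg_mul_eq_one_of_mod_four_eq_one (by omega) hJℓ hJq
  obtain ⟨K, iF, iN, hK, hdK, hH', hcl⟩ := exists_witnessField_of
    (N := (⟨0, -8 * (p : ℚ), 0, 8 * (p : ℚ) ^ 2, 0⟩ : WeierstrassCurve ℚ).conductorNorm ℤ) hℓ hℓ8 hq₀ hq₀8 hJ
    (classNumber_lt_of_count hℓ hq₀ hh) (fun r hr hrN => eq_two_or_eq_of_prime_dvd_conductorNorm_Bdual hp hr hrN)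
  refine ⟨K, iF, iN, hK, ?_, hH', ?_, hcl, fun hdvd =>
    absurd (Nat.le_of_dvd (NumberField.classNumber_pos K) hdvd) (not_le.mpr hcl)⟩
  · rw [hdK, Int.natAbs_neg, Int.natAbs_natCast]
    have h3 : 3 ≤ ℓ := by have := hℓ.two_le; omega
    have h5 : 5 ≤ q₀ := by have := hq₀.two_le; omega
    nlinarith
  · rw [hdK, quadraticTwist_Bdual_neg_mul]
    exact L_one_ne_zero_dual_of_primes hBT hH hp hℓ hq₀ (ne_of_jacobiSym_eq_neg_one hp hJℓ).symm
      (ne_of_jacobiSym_eq_neg_one hp hJq).symm (by rintro rfl; omega) (Or.inr hp8) (Or.inl hℓ8) (Or.inr hq₀8)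

end Summit.BirchSwinnertonDyer.BirchSwinnertonDyer.Theorems.BiquadraticEisensteinDescentHeegnerTwistCouplingInSupplySqrtTwoDualCorner

end
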